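import Mathlib.NumberTheory.LSeries.Convolution
import Mathlib.NumberTheory.ArithmeticFunction.Moebius
import HarnessLib

set_option autoImplicit false

/-!
# Crux `PrintCFram.BottomClassIndexLawFiveLe` (stmt-BirchSwinnertonDyer-20372), line `eisenstein-resource-bdp-line` (registry v24):
# (E3) OF THE CUSP-CONJUNCT ASSEMBLY, ALGEBRAIC PART 1 — FINITE MÖBIUS SUMS AND THE EULER-FACTOR SERIES
# `Σ_{c ⊥ m} c^{−u} Π_{ℓ∣c, ℓ∤6m}(1 − 1/ℓ) = L(𝟙_{⊥6m}μ, u+1) · L(𝟙_{⊥m}, u)`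
# (cell `bsd-print-cfram`, width seat `bsd-line-cfram-p1-w5` g6; THEOREMS ONLY, `--supports` 20372; BSD is not proved by any of this)

HONEST FRAMING. Elementary multiplicative number theory in raw-`LSeries` currency (Mathlib `LSeries`, `LSeries.convolution`,
`ArithmeticFunction`); nothing modular, no Euler products as infinite products. Ingredient of the algebraic half of (E3) of the proof
plan for the cusp conjunct «`G = 0 ⟹ ι C = 0`» of the registered stub `stub_cuspCutForm` (crux notes
`Lines/eisenstein-resource-bdp-line-w5g5-cusp-seed.md` §4 (iii)–§5): after the family average (w3 g13's (III),
`FamilyMean.tendsto_sub_one_mul_LSeries_family_euler`) the `(a, b)` double sum collapses onto the sequence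
`h(c) = 𝟙_{c⊥m} Π_{ℓ∣c, ℓ∤6m}(1 − 1/ℓ)`, whose Dirichlet series this file evaluates:

* `sum_divisors_moebius_mul_eq_prod_primeFactors` — `Σ_{d∣n} μ(d) F(d) = Π_{p∣n}(1 − F(p))` for multiplicative `F` and ANY `n ≥ 1`
  (Mathlib has the squarefree case `IsMultiplicative.prodPrimeFactors_one_sub_of_squarefree`); specialisations
  `sum_divisors_moebius_ite_coprime_eq_prod`, `sum_divisors_sq_moebius_ite_coprime_eq_prod` (`Σ_{b∣c², b⊥M} μ(b)b^{−j} =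
  Π_{ℓ∣c, ℓ∤M}(1 − ℓ^{−j})`);
* `convolution_coprimeMoebiusDiv_coprimeOne` — `h = (𝟙_{⊥6m} μ·id^{−1}) ⋆ 𝟙_{⊥m}` pointwise; **`LSeries_eulerFactorSeq_eq`** —
  `L(h, u) = L(𝟙_{⊥6m}μ, u+1) · L(𝟙_{⊥m}, u)` for `Re u > 1` (so that, with w3 g13's `FamilyMean.LSeries_coprime_mul_LSeries_coprimeMoebius`,
  the factor `L(𝟙_{⊥6m}μ, 2k+1)` cancels the `ζ^{(6m)}(2k+1)` of Lemma B — the «`ζ(2k+1)` disappears» step of the crux notes §5).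

The collapse itself is the companion file `…CuspSeedDoubleSumCollapse.lean`. [folklore]
References: [MontgomeryVaughan2007] §1.3 (Dirichlet convolution, Möbius inversion); [IrelandRosen1982] Ch. 2 §2.
-/

-- summit-side namespace `Summit.BirchSwinnertonDyer.BirchSwinnertonDyer.…` (single-conjunct summit, D-0017 layout)
set_option linter.dupNamespace false

namespace Summit.BirchSwinnertonDyer.BirchSwinnertonDyer.Theorems.PrintCFram.CuspSeed

open LSeries ArithmeticFunction Finset
open scoped LSeries.notation ArithmeticFunction.Moebius ArithmeticFunction.zeta

/-! ## §1 A finite Möbius sum as a product over prime factors -/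

/-- **`Σ_{d ∣ n} μ(d) F(d) = Π_{p ∣ n} (1 − F(p))`** for a multiplicative arithmetic function `F` and `n ≥ 1` (Mathlib has the
squarefree case `IsMultiplicative.prodPrimeFactors_one_sub_of_squarefree`; in general both sides are multiplicative in `n` and
agree on prime powers). [folklore] -/
theorem sum_divisors_moebius_mul_eq_prod_primeFactors {F : ArithmeticFunction ℂ} (hF : F.IsMultiplicative) {n : ℕ}
    (hn : n ≠ 0) : ∑ d ∈ n.divisors, (μ d : ℂ) * F d = ∏ p ∈ n.primeFactors, (1 - F p) := by
  -- both sides as arithmetic functions of `n`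
  have hL : ((pmul (μ : ArithmeticFunction ℂ) F) * ζ : ArithmeticFunction ℂ) = prodPrimeFactors (fun p ↦ 1 - F p) := by
    refine (IsMultiplicative.eq_iff_eq_on_prime_powers _
      ((isMultiplicative_moebius.intCast.pmul hF).mul isMultiplicative_zeta.natCast) _
      (IsMultiplicative.prodPrimeFactors _)).mpr fun p i hp ↦ ?_
    rcases Nat.eq_zero_or_pos i with rfl | hi
    · rw [pow_zero, ((isMultiplicative_moebius.intCast.pmul hF).mul isMultiplicative_zeta.natCast).map_one,
        (IsMultiplicative.prodPrimeFactors (R := ℂ) (fun p ↦ 1 - F p)).map_one]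
    rw [coe_mul_zeta_apply, prodPrimeFactors_apply (pow_ne_zero i hp.ne_zero), Nat.primeFactors_prime_pow hi.ne' hp,
      prod_singleton, Nat.sum_divisors_prime_pow hp]
    simp only [pmul_apply, intCoe_apply]
    rw [Finset.sum_eq_add_of_mem 0 1 (by simp) (by simp; omega) zero_ne_one fun j _ hj ↦ ?_]
    · rw [pow_zero, pow_one, ArithmeticFunction.moebius_apply_one, ArithmeticFunction.moebius_apply_prime hp, hF.map_one]
      push_cast
      ring
    · have hj2 : 2 ≤ j := by omega
      rw [ArithmeticFunction.moebius_apply_prime_pow hp (by omega : j ≠ 0), if_neg (by omega)]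
      simp
  have h := congrArg (fun f : ArithmeticFunction ℂ ↦ f n) hL
  simpa only [coe_mul_zeta_apply, pmul_apply, intCoe_apply, prodPrimeFactors_apply hn] using h

/-- The sequence `b ↦ 𝟙_{b ⊥ M} · b^{−j}` (`j : ℕ`) is a multiplicative arithmetic function. [folklore] -/
theorem isMultiplicative_toArithmeticFunction_ite_coprime_pow_neg (M j : ℕ) :
    (toArithmeticFunction (fun b : ℕ ↦ if b.Coprime M then ((b : ℂ) ^ j)⁻¹ else 0)).IsMultiplicative := by
  refine ⟨by simp [toArithmeticFunction], fun {a b} hab ↦ ?_⟩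
  rcases eq_or_ne a 0 with rfl | ha
  · simp [toArithmeticFunction]
  rcases eq_or_ne b 0 with rfl | hb
  · simp [toArithmeticFunction]
  simp only [toArithmeticFunction, ArithmeticFunction.coe_mk, mul_ne_zero ha hb, ha, hb, if_false]
  by_cases h1 : a.Coprime M
  · by_cases h2 : b.Coprime M
    · rw [if_pos (Nat.Coprime.mul_left h1 h2), if_pos h1, if_pos h2, Nat.cast_mul, mul_pow, mul_inv]
    · have : ¬ (a * b).Coprime M := fun h ↦ h2 (Nat.Coprime.coprime_dvd_left (Dvd.intro_left a rfl) h)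
      rw [if_neg this, if_neg h2, mul_zero]
  · have : ¬ (a * b).Coprime M := fun h ↦ h1 (Nat.Coprime.coprime_dvd_left (Dvd.intro b rfl) h)
    rw [if_neg this, if_neg h1, zero_mul]

/-- **`Σ_{b ∣ n, b ⊥ M} μ(b) b^{−j} = Π_{ℓ ∣ n, ℓ ∤ M} (1 − ℓ^{−j})`** (`n, M ≥ 1`). [folklore] -/
theorem sum_divisors_moebius_ite_coprime_eq_prod {M : ℕ} (hM : M ≠ 0) (j : ℕ) {n : ℕ} (hn : n ≠ 0) :
    ∑ b ∈ n.divisors, (μ b : ℂ) * (if b.Coprime M then ((b : ℂ) ^ j)⁻¹ else 0) =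
      ∏ ℓ ∈ n.primeFactors \ M.primeFactors, (1 - ((ℓ : ℂ) ^ j)⁻¹) := by
  have h := sum_divisors_moebius_mul_eq_prod_primeFactors (isMultiplicative_toArithmeticFunction_ite_coprime_pow_neg M j) hn
  have h' : ∀ d ∈ n.divisors, (μ d : ℂ) * (toArithmeticFunction (fun b : ℕ ↦ if b.Coprime M then ((b : ℂ) ^ j)⁻¹ else 0)) d
      = (μ d : ℂ) * (if d.Coprime M then ((d : ℂ) ^ j)⁻¹ else 0) := by
    intro d hd
    have hd0 : d ≠ 0 := Nat.ne_of_gt (Nat.pos_of_mem_divisors hd)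
    simp [toArithmeticFunction, hd0]
  rw [Finset.sum_congr rfl h'] at h
  rw [h]
  -- split the product over `n.primeFactors` into `ℓ ∉ M.primeFactors` (factor `1 − ℓ^{−j}`) and `ℓ ∈ M.primeFactors` (factor `1`)
  rw [← Finset.prod_filter_mul_prod_filter_not n.primeFactors (fun ℓ ↦ ℓ ∈ M.primeFactors)]
  have h1 : ∏ ℓ ∈ n.primeFactors with ℓ ∈ M.primeFactors,
      (1 - (toArithmeticFunction (fun b : ℕ ↦ if b.Coprime M then ((b : ℂ) ^ j)⁻¹ else 0)) ℓ) = 1 := by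
    refine Finset.prod_eq_one fun ℓ hℓ ↦ ?_
    rw [Finset.mem_filter] at hℓ
    have hℓM : ¬ ℓ.Coprime M := by
      rw [Nat.Prime.coprime_iff_not_dvd (Nat.prime_of_mem_primeFactors hℓ.1)]
      exact not_not.mpr (Nat.dvd_of_mem_primeFactors hℓ.2)
    simp [toArithmeticFunction, (Nat.prime_of_mem_primeFactors hℓ.1).ne_zero, hℓM]
  have h2 : (n.primeFactors.filter fun ℓ ↦ ¬ ℓ ∈ M.primeFactors) = n.primeFactors \ M.primeFactors := by
    ext ℓ; simp [Finset.mem_sdiff]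
  rw [h1, one_mul, h2]
  refine Finset.prod_congr rfl fun ℓ hℓ ↦ ?_
  rw [Finset.mem_sdiff] at hℓ
  have hℓp := Nat.prime_of_mem_primeFactors hℓ.1
  have hℓM : ℓ.Coprime M := (Nat.Prime.coprime_iff_not_dvd hℓp).mpr fun h ↦ hℓ.2 (Nat.mem_primeFactors.mpr ⟨hℓp, h, hM⟩)
  simp [toArithmeticFunction, hℓp.ne_zero, hℓM]

/-- **`ρ(c²) = Σ_{b ∣ c², b ⊥ M} μ(b) b^{−j} = Π_{ℓ ∣ c, ℓ ∤ M} (1 − ℓ^{−j})`** (`c, M ≥ 1`): only squarefree `b` contribute.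
[folklore] -/
theorem sum_divisors_sq_moebius_ite_coprime_eq_prod {M : ℕ} (hM : M ≠ 0) (j : ℕ) {c : ℕ} (hc : c ≠ 0) :
    ∑ b ∈ (c ^ 2).divisors, (μ b : ℂ) * (if b.Coprime M then ((b : ℂ) ^ j)⁻¹ else 0) =
      ∏ ℓ ∈ c.primeFactors \ M.primeFactors, (1 - ((ℓ : ℂ) ^ j)⁻¹) := by
  rw [sum_divisors_moebius_ite_coprime_eq_prod hM j (pow_ne_zero 2 hc), Nat.primeFactors_pow _ two_ne_zero]

/-! ## §2 The Euler-factor sequence `h(c) = 𝟙_{c ⊥ m} Π_{ℓ ∣ c, ℓ ∤ 6m} (1 − 1/ℓ)` as a Dirichlet convolution -/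

/-- `h = (𝟙_{⊥6m} μ · id^{−1}) ⋆ 𝟙_{⊥m}` pointwise: for `c ⊥ m` the convolution is `Σ_{b ∣ c, b ⊥ 6m} μ(b)/b = Π_{ℓ∣c, ℓ∤6m}(1 − 1/ℓ)`,
and for `c` not prime to `m` every term vanishes (`c ≥ 1`). [folklore] -/
theorem convolution_coprimeMoebiusDiv_coprimeOne {m : ℕ} (hm : m ≠ 0) {c : ℕ} (hc0 : c ≠ 0) :
    ((fun b : ℕ ↦ if b.Coprime (6 * m) then (μ b : ℂ) * ((b : ℂ) ^ 1)⁻¹ else 0) ⍟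
        (fun a : ℕ ↦ if a.Coprime m then (1 : ℂ) else 0)) c =
      if c.Coprime m then ∏ ℓ ∈ c.primeFactors \ (6 * m).primeFactors, (1 - ((ℓ : ℂ) ^ 1)⁻¹) else 0 := by
  rw [convolution_def]
  simp only
  split_ifs with hc
  · rw [← sum_divisors_moebius_ite_coprime_eq_prod (mul_ne_zero (by norm_num) hm) 1 hc0,
      ← Nat.sum_divisorsAntidiagonal (f := fun b _ ↦ (μ b : ℂ) * (if b.Coprime (6 * m) then ((b : ℂ) ^ 1)⁻¹ else 0))]
    refine Finset.sum_congr rfl fun p hp ↦ ?_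
    obtain ⟨hpc, -⟩ := Nat.mem_divisorsAntidiagonal.1 hp
    have h2 : p.2.Coprime m := Nat.Coprime.coprime_dvd_left ⟨p.1, by rw [mul_comm]; exact hpc.symm⟩ hc
    rw [if_pos h2, mul_one]
    split_ifs <;> simp
  · refine Finset.sum_eq_zero fun p hp ↦ ?_
    obtain ⟨hpc, -⟩ := Nat.mem_divisorsAntidiagonal.1 hp
    by_cases h1 : p.1.Coprime (6 * m)
    · by_cases h2 : p.2.Coprime m
      · exact absurd (hpc ▸ Nat.Coprime.mul_left (Nat.Coprime.coprime_mul_left_right h1) h2) hc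
      · rw [if_neg h2, mul_zero]
    · rw [if_neg h1, zero_mul]

/-- `L(𝟙_{⊥M} μ · id^{−1}, u) = L(𝟙_{⊥M} μ, u + 1)` (shift of the exponent). [folklore] -/
theorem LSeries_coprimeMoebiusDiv_eq (M : ℕ) (u : ℂ) :
    LSeries (fun b : ℕ ↦ if b.Coprime M then (μ b : ℂ) * ((b : ℂ) ^ 1)⁻¹ else 0) u =
      LSeries (fun b : ℕ ↦ if b.Coprime M then (μ b : ℂ) else 0) (u + 1) := by
  refine tsum_congr fun b ↦ ?_
  rcases eq_or_ne b 0 with rfl | hb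
  · simp [LSeries.term_zero]
  · have hbc : (b : ℂ) ≠ 0 := Nat.cast_ne_zero.mpr hb
    rw [LSeries.term_of_ne_zero hb, LSeries.term_of_ne_zero hb, pow_one, Complex.cpow_add _ _ hbc, Complex.cpow_one]
    split_ifs
    · field_simp
    · simp

/-- `L(𝟙_{⊥M} μ · id^{−1}, u)` converges absolutely for `Re u > 0`. [folklore] -/
theorem LSeriesSummable_coprimeMoebiusDiv (M : ℕ) {u : ℂ} (hu : 0 < u.re) :
    LSeriesSummable (fun b : ℕ ↦ if b.Coprime M then (μ b : ℂ) * ((b : ℂ) ^ 1)⁻¹ else 0) u := by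
  refine LSeriesSummable_of_le_const_mul_rpow hu ⟨1, fun n hn ↦ ?_⟩
  have hn' : (0 : ℝ) < n := by exact_mod_cast Nat.pos_of_ne_zero hn
  split_ifs
  · rw [norm_mul, norm_inv, pow_one, Complex.norm_natCast, Complex.norm_intCast, one_mul, zero_sub,
      Real.rpow_neg_one]
    have h1 : |(μ n : ℝ)| ≤ 1 := by exact_mod_cast abs_moebius_le_one
    exact mul_le_of_le_one_left (inv_nonneg.mpr hn'.le) h1
  · rw [norm_zero]; positivity

/-- **`Σ_{c ⊥ m} c^{−u} Π_{ℓ∣c, ℓ∤6m}(1 − 1/ℓ) = L(𝟙_{⊥6m} μ, u + 1) · L(𝟙_{⊥m}, u)`** for `Re u > 1` — the Dirichlet series of the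
Euler-factor sequence `h` is a product of two elementary `L`-series (convolution `(𝟙_{⊥6m}μ·id^{−1}) ⋆ 𝟙_{⊥m}`). [folklore] -/
theorem LSeries_eulerFactorSeq_eq {m : ℕ} (hm : m ≠ 0) {u : ℂ} (hu : 1 < u.re) :
    LSeries (fun c : ℕ ↦ if c.Coprime m then ∏ ℓ ∈ c.primeFactors \ (6 * m).primeFactors, (1 - ((ℓ : ℂ) ^ 1)⁻¹) else 0) u =
      LSeries (fun b : ℕ ↦ if b.Coprime (6 * m) then (μ b : ℂ) else 0) (u + 1) *
        LSeries (fun a : ℕ ↦ if a.Coprime m then (1 : ℂ) else 0) u := by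
  have hB : LSeriesSummable (fun a : ℕ ↦ if a.Coprime m then (1 : ℂ) else 0) u := by
    refine LSeriesSummable_of_le_const_mul_rpow hu ⟨1, fun n _ ↦ ?_⟩
    rw [sub_self, Real.rpow_zero, mul_one]
    split_ifs <;> simp
  have hA := LSeriesSummable_coprimeMoebiusDiv (6 * m) (u := u) (by linarith)
  rw [← LSeries_coprimeMoebiusDiv_eq, ← LSeries_convolution' hA hB]
  refine LSeries_congr (fun {c} hc ↦ ?_) u
  exact (convolution_coprimeMoebiusDiv_coprimeOne hm hc).symm


end Summit.BirchSwinnertonDyer.BirchSwinnertonDyer.Theorems.PrintCFram.CuspSeed
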